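/-
Copyright (c) 2026 the pub-hodgecm-mathlib formalisation cell (harness21).  Prover seat hodgecm-mathlib-A-p12 (g24), 2026-09-02.  «S3-ram» (LEAD F0P3a-plan (g13); owner p06 (g15);
(Cnt2′) chair F0P3a-p07 (g14)): the W-SIDE PACK of the (α₂) TYPE-(2) line, part 4 — the W-side `bd`, `reg` and `Fix` numbers.  `--supports stmt-HodgeConjecture-24833`.
-/
import Literature.NumberTheory.Rogawski1990.DepthZeroKappaTransferTypeTwoRamifiedWSideLattice     -- ★ p848486 (this seat): conversion `natCard_cosets_eq_ncard_selfDual_fixed`, rank-2 transitivity; ⊇ ★ (B-i)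
import Literature.NumberTheory.Rogawski1990.DepthZeroKappaTransferTypeTwoRamifiedWSideStructure   -- ★ (this seat): `forall_v_conj_sub_one_le_of_twoDeep`, `forall_v_conj_sub_one_sq_le_of_twoDeep`
import HarnessLib

/-!
# The W-side census of a 2-deep type-(2) `Γ`: the `bd` and `reg` families are empty, and the fixed family has `(q+1)Σ_(k<n)q^k` resp. `2Σ_(k≤n)q^k − 1` members
# (Labesse–Langlands 1979 §2; Rogawski 1990 §4.9; Kottwitz 1986 §3)

Topic `NumberTheory/Rogawski1990`; namespace `Literature.NumberTheory.Automorphic.UnitaryGroup`.  THEOREMS ONLY; kernel lane `--supports stmt-HodgeConjecture-24833`; cell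
`pub/hodgecm-mathlib` (D-0151), crux H413, count-neutral; seat A-p12 (g24).  HONEST LABEL: HC_CM is proved only modulo the 2 remaining named inputs (hLiu418 24832, h413 24833).

THE MATHEMATICS.  In the W-side lattice currency of the (Cnt2′) axis census (★ p847852 `ncard_selfDual_fixed_axis_{bd,reg,zero,…}_eq`: families `{B ∣ SD σ_w ϖ J B ∧ Γ·B = B ∧ TOKEN}`,
`Γ ∈ U(σ_w, J)` the W-block, 2-deep, type (2), discriminant depth `N`): every `Γ`-fixed self-dual `B` is `u·𝒪_w²` with `u ∈ U`, `u⁻¹Γu ∈ GL₂(𝒪_w)` (★ part 1), so by ★ part 3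
(`LEV(ϖ)` and, for `N ≥ 2`, `LEV₂(ϖ³)` are automatic) (§1) the `bd` family `{¬LEV(ϖ)}` and the `reg` family `{LEV(ϖ) ∧ ¬LEV(ϖ²) ∧ ¬LEV₂(ϖ³)}` are EMPTY; and (§2) the whole fixed
family `{B ∣ SD, ΓB = B}` is the depth-`0` ball of ★ (B-i): **`(q+1)·Σ_(k<n) q^k`** members at even depth `2n`, **`m + 1 = 2·Σ_(k<n+1) q^k`** at odd depth `2n+1` — so with ★ part 1's
ZERO counts the rank-one shell `{LEV(ϖ) ∧ ¬LEV(ϖ²) ∧ LEV₂(ϖ³)} = Fix ∖ LEV(ϖ²)` has `(q+1)·q^(n−1)` resp. `2·q^n` members, split evenly between the two classes by ★ part 2.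

* §1 `selfDual_fixed_bd_eq_empty`, `selfDual_fixed_reg_eq_empty` (`N ≥ 2`) — at the `GL₂` level, any 2-deep type-(2) `Γ ∈ U(σ_w, Φ₂)`.
* §2 `ncard_selfDual_fixed_of_even_depth_ramified`, `ncard_selfDual_fixed_of_odd_depth_ramified` (the `cmDatum` currency of ★ (B-i)).

## References
* [LabesseLanglands1979] J.-P. Labesse, R. P. Langlands, *L-indistinguishability for SL(2)*, Canad. J. Math. 31 (1979): §2 Lemma 2.1 p. 8.
* [Rogawski1990] J. D. Rogawski, *Automorphic Representations of Unitary Groups in Three Variables* (1990): §4.9 pp. 54–56.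
* [Kottwitz1986] R. Kottwitz, *Base change for unit elements of Hecke algebras*, Compositio Math. 60 (1986): §3.
-/

set_option autoImplicit false

noncomputable section

open MeasureTheory Measure Set NumberField IsDedekindDomain Matrix ValuativeRel MulAction Finset Polynomial
open scoped ValuativeRel Matrix MatrixGroups WithZero

namespace Literature.NumberTheory.Automorphic.UnitaryGroup

open Literature.NumberTheory.Rogawski1990 Literature.NumberTheory.Automorphic Literature.NumberTheory.Automorphic.IntegralReduction
open Literature.NumberTheory.Automorphic.UnitaryLatticeTree Literature.NumberTheory.Automorphic.HermitianLattice Literature.GroupTheory Literature.NumberTheory.GaloisRepresentations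

section Census

variable (L : Type) [Field L] [NumberField L] [IsCMField L] (v : HeightOneSpectrum (𝓞 ↥(maximalRealSubfield L)))
  (w : PlacesOver L v) (hw : IsCMField.complexConj L • w.1 = w.1)

/-! ## §1 The `bd` and `reg` families are empty -/

set_option maxHeartbeats 800000 in
include hw in
/-- **THE W-SIDE `bd` FAMILY IS EMPTY**: for a 2-deep type-(2) `Γ ∈ U(σ_w, Φ₂)` of discriminant depth `N ≥ 1`, no `Γ`-fixed self-dual lattice `B ⊂ L_w²` violates `LEV(ϖ)`:
`{B ∣ SD σ_w ϖ′ J B ∧ Γ·B = B ∧ ¬ (Γ−1)B ⊆ ϖB} = ∅` (★ `forall_v_conj_sub_one_le_of_twoDeep` on `B = u·𝒪_w²`). [cite: LabesseLanglands1979, §2 Lemma 2.1 p. 8] [cite: Kottwitz1986, §3] -/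
theorem selfDual_fixed_bd_eq_empty (he : v.asIdeal.ramificationIdx' w.1.asIdeal ≠ 1) (h2 : IsUnit (2 : 𝒪[(w.1.adicCompletion L)]))
    (ϖ : (w.1.adicCompletion L)ˣ) (hϖ : Valued.v (ϖ : (w.1.adicCompletion L)) = WithZero.exp (-1 : ℤ))
    (hσϖ : (galAdicCompletionMap (L := L) (IsCMField.complexConj L) hw) (ϖ : (w.1.adicCompletion L)) = -(ϖ : (w.1.adicCompletion L))) {ϖ' : (w.1.adicCompletion L)}
    (Γ : GL (Fin 2) (w.1.adicCompletion L)) (hΓ : Γ ∈ unitaryGroupOfForm (galAdicCompletionMap (L := L) (IsCMField.complexConj L) hw) (placeForm (Matrix.of fun i j : Fin 2 => if i.val + j.val + 1 = 2 then (1 : L) else 0) w.1))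
    (h2deep : ∀ i j : Fin 2, Valued.v (((Γ : Matrix (Fin 2) (Fin 2) (w.1.adicCompletion L)) - 1) i j) ≤ Valued.v ((ϖ : (w.1.adicCompletion L)) ^ 2))
    {N : ℕ} (hN1 : 1 ≤ N) (hN : Valued.v ((Γ : Matrix (Fin 2) (Fin 2) (w.1.adicCompletion L)).trace ^ 2 - 4 * (Γ : Matrix (Fin 2) (Fin 2) (w.1.adicCompletion L)).det) = WithZero.exp (-((2 * N : ℕ) : ℤ))) :
    {B : Submodule (Valued.integer (w.1.adicCompletion L)) (Fin 2 → (w.1.adicCompletion L)) | UnitaryLatticeTree.IsSelfDualLattice (galAdicCompletionMap (L := L) (IsCMField.complexConj L) hw) ϖ' (!![(0 : (w.1.adicCompletion L)), 1; 1, 0] : Matrix (Fin 2) (Fin 2) (w.1.adicCompletion L)) B ∧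
        UnitaryLatticeTree.mapGL Γ B = B ∧
        ¬ B.map ((Matrix.toLin' ((Γ : Matrix (Fin 2) (Fin 2) (w.1.adicCompletion L)) - 1)).restrictScalars (Valued.integer (w.1.adicCompletion L))) ≤ UnitaryLatticeTree.scaleLattice (ϖ : (w.1.adicCompletion L)) B} = ∅ := by
  have hϖ0 : (ϖ : (w.1.adicCompletion L)) ≠ 0 := ϖ.ne_zero
  have hUeq : unitaryGroupOfForm (galAdicCompletionMap (L := L) (IsCMField.complexConj L) hw) (placeForm (Matrix.of fun i j : Fin 2 => if i.val + j.val + 1 = 2 then (1 : L) else 0) w.1) = unitaryGroupOfForm (galAdicCompletionMap (L := L) (IsCMField.complexConj L) hw) (!![(0 : (w.1.adicCompletion L)), 1; 1, 0] : Matrix (Fin 2) (Fin 2) (w.1.adicCompletion L)) := by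
    rw [unitaryGroupOfForm_placeForm_antidiagTwo_eq]
  have hΓJ : Γ ∈ unitaryGroupOfForm (galAdicCompletionMap (L := L) (IsCMField.complexConj L) hw) (!![(0 : (w.1.adicCompletion L)), 1; 1, 0] : Matrix (Fin 2) (Fin 2) (w.1.adicCompletion L)) := by rw [← hUeq]; exact hΓ
  ext B
  simp only [Set.mem_setOf_eq, Set.mem_empty_iff_false, iff_false, not_and, not_not]
  intro hsd hfix
  obtain ⟨u, rfl⟩ := exists_unitary_mapGL_stdLattice_eq_of_isSelfDualLattice_two L v w hw he h2 B hsd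
  have hug : (((u⁻¹ * ⟨Γ, hΓJ⟩ * u : ↥(unitaryGroupOfForm (galAdicCompletionMap (L := L) (IsCMField.complexConj L) hw) (!![(0 : (w.1.adicCompletion L)), 1; 1, 0] : Matrix (Fin 2) (Fin 2) (w.1.adicCompletion L))))) : GL (Fin 2) (w.1.adicCompletion L)) ∈ glInt 2 (w.1.adicCompletion L) :=
    (mapGL_mapGL_stdLattice_eq_iff_mem_glInt (galAdicCompletionMap (L := L) (IsCMField.complexConj L) hw) _ ⟨Γ, hΓJ⟩ u).1 hfix
  rw [Subgroup.coe_mul, Subgroup.coe_mul, Subgroup.coe_inv] at hug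
  rw [map_toLin'_mapGL_stdLattice_le_scaleLattice_iff hϖ0, ← units_coe_inv_mul_mul_sub_one_eq_conj]
  exact forall_v_conj_sub_one_le_of_twoDeep L v w hw he h2 ϖ hϖ hσϖ Γ (u : GL (Fin 2) (w.1.adicCompletion L)) hΓ (by rw [hUeq]; exact u.2) h2deep hN1 hN hug

set_option maxHeartbeats 800000 in
include hw in
/-- **THE W-SIDE `reg` FAMILY IS EMPTY (`N ≥ 2`)**: for a 2-deep type-(2) `Γ ∈ U(σ_w, Φ₂)` of discriminant depth `N ≥ 2`, no `Γ`-fixed self-dual lattice satisfies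
`LEV(ϖ) ∧ ¬LEV(ϖ²) ∧ ¬LEV₂(ϖ³)` — `LEV₂(ϖ³)` is automatic (★ `forall_v_conj_sub_one_sq_le_of_twoDeep`). [cite: LabesseLanglands1979, §2 Lemma 2.1 p. 8] [cite: Kottwitz1986, §3] -/
theorem selfDual_fixed_reg_eq_empty (he : v.asIdeal.ramificationIdx' w.1.asIdeal ≠ 1) (h2 : IsUnit (2 : 𝒪[(w.1.adicCompletion L)]))
    (ϖ : (w.1.adicCompletion L)ˣ) (hϖ : Valued.v (ϖ : (w.1.adicCompletion L)) = WithZero.exp (-1 : ℤ))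
    (hσϖ : (galAdicCompletionMap (L := L) (IsCMField.complexConj L) hw) (ϖ : (w.1.adicCompletion L)) = -(ϖ : (w.1.adicCompletion L))) {ϖ' : (w.1.adicCompletion L)}
    (Γ : GL (Fin 2) (w.1.adicCompletion L)) (hΓ : Γ ∈ unitaryGroupOfForm (galAdicCompletionMap (L := L) (IsCMField.complexConj L) hw) (placeForm (Matrix.of fun i j : Fin 2 => if i.val + j.val + 1 = 2 then (1 : L) else 0) w.1))
    (h2deep : ∀ i j : Fin 2, Valued.v (((Γ : Matrix (Fin 2) (Fin 2) (w.1.adicCompletion L)) - 1) i j) ≤ Valued.v ((ϖ : (w.1.adicCompletion L)) ^ 2))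
    {N : ℕ} (hN2 : 2 ≤ N) (hN : Valued.v ((Γ : Matrix (Fin 2) (Fin 2) (w.1.adicCompletion L)).trace ^ 2 - 4 * (Γ : Matrix (Fin 2) (Fin 2) (w.1.adicCompletion L)).det) = WithZero.exp (-((2 * N : ℕ) : ℤ))) :
    {B : Submodule (Valued.integer (w.1.adicCompletion L)) (Fin 2 → (w.1.adicCompletion L)) | UnitaryLatticeTree.IsSelfDualLattice (galAdicCompletionMap (L := L) (IsCMField.complexConj L) hw) ϖ' (!![(0 : (w.1.adicCompletion L)), 1; 1, 0] : Matrix (Fin 2) (Fin 2) (w.1.adicCompletion L)) B ∧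
        UnitaryLatticeTree.mapGL Γ B = B ∧
        (B.map ((Matrix.toLin' ((Γ : Matrix (Fin 2) (Fin 2) (w.1.adicCompletion L)) - 1)).restrictScalars (Valued.integer (w.1.adicCompletion L))) ≤ UnitaryLatticeTree.scaleLattice (ϖ : (w.1.adicCompletion L)) B ∧
          ¬ B.map ((Matrix.toLin' ((Γ : Matrix (Fin 2) (Fin 2) (w.1.adicCompletion L)) - 1)).restrictScalars (Valued.integer (w.1.adicCompletion L))) ≤ UnitaryLatticeTree.scaleLattice ((ϖ : (w.1.adicCompletion L)) ^ 2) B ∧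
          ¬ B.map ((Matrix.toLin' (((Γ : Matrix (Fin 2) (Fin 2) (w.1.adicCompletion L)) - 1) ^ 2)).restrictScalars (Valued.integer (w.1.adicCompletion L))) ≤ UnitaryLatticeTree.scaleLattice ((ϖ : (w.1.adicCompletion L)) ^ 3) B)} = ∅ := by
  have hϖ0 : (ϖ : (w.1.adicCompletion L)) ≠ 0 := ϖ.ne_zero
  have hUeq : unitaryGroupOfForm (galAdicCompletionMap (L := L) (IsCMField.complexConj L) hw) (placeForm (Matrix.of fun i j : Fin 2 => if i.val + j.val + 1 = 2 then (1 : L) else 0) w.1) = unitaryGroupOfForm (galAdicCompletionMap (L := L) (IsCMField.complexConj L) hw) (!![(0 : (w.1.adicCompletion L)), 1; 1, 0] : Matrix (Fin 2) (Fin 2) (w.1.adicCompletion L)) := by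
    rw [unitaryGroupOfForm_placeForm_antidiagTwo_eq]
  have hΓJ : Γ ∈ unitaryGroupOfForm (galAdicCompletionMap (L := L) (IsCMField.complexConj L) hw) (!![(0 : (w.1.adicCompletion L)), 1; 1, 0] : Matrix (Fin 2) (Fin 2) (w.1.adicCompletion L)) := by rw [← hUeq]; exact hΓ
  ext B
  simp only [Set.mem_setOf_eq, Set.mem_empty_iff_false, iff_false, not_and, not_not]
  intro hsd hfix _ _
  obtain ⟨u, rfl⟩ := exists_unitary_mapGL_stdLattice_eq_of_isSelfDualLattice_two L v w hw he h2 _ hsd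
  have hug : (((u⁻¹ * ⟨Γ, hΓJ⟩ * u : ↥(unitaryGroupOfForm (galAdicCompletionMap (L := L) (IsCMField.complexConj L) hw) (!![(0 : (w.1.adicCompletion L)), 1; 1, 0] : Matrix (Fin 2) (Fin 2) (w.1.adicCompletion L))))) : GL (Fin 2) (w.1.adicCompletion L)) ∈ glInt 2 (w.1.adicCompletion L) :=
    (mapGL_mapGL_stdLattice_eq_iff_mem_glInt (galAdicCompletionMap (L := L) (IsCMField.complexConj L) hw) _ ⟨Γ, hΓJ⟩ u).1 hfix
  rw [Subgroup.coe_mul, Subgroup.coe_mul, Subgroup.coe_inv] at hug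
  rw [map_toLin'_mapGL_stdLattice_le_scaleLattice_iff (pow_ne_zero 3 hϖ0), coe_inv_mul_sub_one_sq_mul, pow_two]
  exact forall_v_conj_sub_one_sq_le_of_twoDeep L v w hw he h2 ϖ hϖ hσϖ Γ (u : GL (Fin 2) (w.1.adicCompletion L)) hΓ (by rw [hUeq]; exact u.2) h2deep hN2 hN hug

/-! ## §2 The whole fixed family: the depth-`0` ball of ★ (B-i) -/

set_option maxHeartbeats 1600000 in
include hw in
/-- **THE FIXED FAMILY READ ON COSETS**: for `γ₂ ∈ U₂(L⁺_v)` 2-deep at `w`, `{B ∣ SD σ_w ϖ J B ∧ Γ·B = B}` has the size of the depth-`0` ball `{hK⁰ : |(E₂(h⁻¹γ₂h) − ½trΓ·1)_{ab}|_w ≤ 1}` of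
★ (B-i) (`j = 0`). [cite: Kottwitz1986, §3] [cite: Rogawski1990, §4.9 p. 54] -/
theorem ncard_selfDual_fixed_eq_natCard_depthZero (he : v.asIdeal.ramificationIdx' w.1.asIdeal ≠ 1) (h2 : IsUnit (2 : 𝒪[(w.1.adicCompletion L)]))
    (ϖ : (w.1.adicCompletion L)ˣ) (hϖ : Valued.v (ϖ : (w.1.adicCompletion L)) = WithZero.exp (-1 : ℤ)) (γ₂ : ((cmDatum L 2 (Matrix.of fun i j : Fin 2 => if i.val + j.val + 1 = 2 then (1 : L) else 0)).Local v))
    (h2deep : ∀ i j : Fin 2, Valued.v ((((((localNonsplitEquiv (IsCMField.complexConj L) (Matrix.of fun i j : Fin 2 => if i.val + j.val + 1 = 2 then (1 : L) else 0) (IsCMField.complexConj_ne_one L) w hw) (γ₂) : ↥(unitaryGroupOfForm (galAdicCompletionMap (L := L) (IsCMField.complexConj L) hw) (placeForm (Matrix.of fun i j : Fin 2 => if i.val + j.val + 1 = 2 then (1 : L) else 0) w.1))) : GL (Fin 2) (w.1.adicCompletion L)) : Matrix (Fin 2) (Fin 2) (w.1.adicCompletion L)) - 1) i j) ≤ Valued.v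 ((ϖ : (w.1.adicCompletion L)) ^ 2)) :
    {B : Submodule (Valued.integer (w.1.adicCompletion L)) (Fin 2 → (w.1.adicCompletion L)) | UnitaryLatticeTree.IsSelfDualLattice (galAdicCompletionMap (L := L) (IsCMField.complexConj L) hw) (ϖ : (w.1.adicCompletion L)) (!![(0 : (w.1.adicCompletion L)), 1; 1, 0] : Matrix (Fin 2) (Fin 2) (w.1.adicCompletion L)) B ∧
        UnitaryLatticeTree.mapGL ((((localNonsplitEquiv (IsCMField.complexConj L) (Matrix.of fun i j : Fin 2 => if i.val + j.val + 1 = 2 then (1 : L) else 0) (IsCMField.complexConj_ne_one L) w hw) (γ₂) : ↥(unitaryGroupOfForm (galAdicCompletionMap (L := L) (IsCMField.complexConj L) hw) (placeForm (Matrix.of fun i j : Fin 2 => if i.val + j.val + 1 = 2 then (1 : L) else 0) w.1))) : GL (Fin 2) (w.1.adicCompletion L))) B = B}.ncard =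
      Nat.card {x : ((cmDatum L 2 (Matrix.of fun i j : Fin 2 => if i.val + j.val + 1 = 2 then (1 : L) else 0)).Local v) ⧸ (cmLocalIntegralLevel L 2 (Matrix.of fun i j : Fin 2 => if i.val + j.val + 1 = 2 then (1 : L) else 0) v) | ∃ h : ((cmDatum L 2 (Matrix.of fun i j : Fin 2 => if i.val + j.val + 1 = 2 then (1 : L) else 0)).Local v), x = (h : ((cmDatum L 2 (Matrix.of fun i j : Fin 2 => if i.val + j.val + 1 = 2 then (1 : L) else 0)).Local v) ⧸ (cmLocalIntegralLevel L 2 (Matrix.of fun i j : Fin 2 => if i.val + j.val + 1 = 2 then (1 : L) else 0) v)) ∧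
        ∀ a b : Fin 2, Valued.v ((((((localNonsplitEquiv (IsCMField.complexConj L) (Matrix.of fun i j : Fin 2 => if i.val + j.val + 1 = 2 then (1 : L) else 0) (IsCMField.complexConj_ne_one L) w hw) (h⁻¹ * γ₂ * h) : ↥(unitaryGroupOfForm (galAdicCompletionMap (L := L) (IsCMField.complexConj L) hw) (placeForm (Matrix.of fun i j : Fin 2 => if i.val + j.val + 1 = 2 then (1 : L) else 0) w.1))) : GL (Fin 2) (w.1.adicCompletion L)) : Matrix (Fin 2) (Fin 2) (w.1.adicCompletion L)) - ((((((localNonsplitEquiv (IsCMField.complexConj L) (Matrix.of fun i j : Fin 2 => if i.val + j.val + 1 = 2 then (1 : L) else 0) (IsCMField.complexConj_ne_one L) w hw) (γ₂) : ↥(unitaryGroupOfForm (galAdicCompletionMap (L := L) (IsCMField.complexConj L) hw) (placeForm (Matrix.of fun i j : Fin 2 => if i.val + j.val + 1 = 2 then (1 : L) else 0) w.1))) : GL (Fin 2) (w.1.adicCompletion L)) : Matrix (Fin 2) (Fin 2) (w.1.adicCompletion L))).trace / 2) • (1 : Matrix (Fin 2) (Fin 2) (w.1.adicCompletion L))) a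 b) ≤ Valued.v ((ϖ : (w.1.adicCompletion L)) ^ (2 * 0))} := by
  have hϖ1 : Valued.v (ϖ : (w.1.adicCompletion L)) ≤ 1 := by rw [hϖ, ← WithZero.exp_zero]; exact WithZero.exp_le_exp.2 (by norm_num)
  have h2w : Valued.v (2 : (w.1.adicCompletion L)) = 1 := (isUnit_two_integer_iff_valued_eq_one L w.1).1 h2
  have hc1 : Valued.v ((((((localNonsplitEquiv (IsCMField.complexConj L) (Matrix.of fun i j : Fin 2 => if i.val + j.val + 1 = 2 then (1 : L) else 0) (IsCMField.complexConj_ne_one L) w hw) (γ₂) : ↥(unitaryGroupOfForm (galAdicCompletionMap (L := L) (IsCMField.complexConj L) hw) (placeForm (Matrix.of fun i j : Fin 2 => if i.val + j.val + 1 = 2 then (1 : L) else 0) w.1))) : GL (Fin 2) (w.1.adicCompletion L)) : Matrix (Fin 2) (Fin 2) (w.1.adicCompletion L))).trace / 2) ≤ 1 := by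
    have e : (((((localNonsplitEquiv (IsCMField.complexConj L) (Matrix.of fun i j : Fin 2 => if i.val + j.val + 1 = 2 then (1 : L) else 0) (IsCMField.complexConj_ne_one L) w hw) (γ₂) : ↥(unitaryGroupOfForm (galAdicCompletionMap (L := L) (IsCMField.complexConj L) hw) (placeForm (Matrix.of fun i j : Fin 2 => if i.val + j.val + 1 = 2 then (1 : L) else 0) w.1))) : GL (Fin 2) (w.1.adicCompletion L)) : Matrix (Fin 2) (Fin 2) (w.1.adicCompletion L))).trace / 2 = (((((((localNonsplitEquiv (IsCMField.complexConj L) (Matrix.of fun i j : Fin 2 => if i.val + j.val + 1 = 2 then (1 : L) else 0) (IsCMField.complexConj_ne_one L) w hw) (γ₂) : ↥(unitaryGroupOfForm (galAdicCompletionMap (L := L) (IsCMField.complexConj L) hw) (placeForm (Matrix.of fun i j : Fin 2 => if i.val + j.val + 1 = 2 then (1 : L) else 0) w.1))) : GL (Fin 2) (w.1.adicCompletion L)) : Matrix (Fin 2) (Fin 2) (w.1.adicCompletion L)) - 1) 0 0 + (((((localNonsplitEquiv (IsCMField.complexConj L) (Matrix.of fun i j : Fin 2 => if i.val + j.val + 1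 = 2 then (1 : L) else 0) (IsCMField.complexConj_ne_one L) w hw) (γ₂) : ↥(unitaryGroupOfForm (galAdicCompletionMap (L := L) (IsCMField.complexConj L) hw) (placeForm (Matrix.of fun i j : Fin 2 => if i.val + j.val + 1 = 2 then (1 : L) else 0) w.1))) : GL (Fin 2) (w.1.adicCompletion L)) : Matrix (Fin 2) (Fin 2) (w.1.adicCompletion L)) - 1) 1 1) / 2) + 1 := by
      rw [Matrix.trace_fin_two]; simp only [Matrix.sub_apply, Matrix.one_apply_eq]; ring
    rw [e]
    refine le_trans (Valuation.map_add _ _ _) (max_le ?_ (by rw [map_one]))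
    rw [map_div₀, h2w, div_one]
    refine le_trans (Valuation.map_add _ _ _) (max_le (le_trans (h2deep 0 0) ?_) (le_trans (h2deep 1 1) ?_)) <;>
      (rw [map_pow]; exact pow_le_one₀ zero_le hϖ1)
  -- the coset token `entries of (Y − c1) ≤ 1` ⟺ `Y` integral (given `|c| ≤ 1`)
  have hiff : ∀ Y : Matrix (Fin 2) (Fin 2) (w.1.adicCompletion L), (∀ a b : Fin 2, Valued.v (Y a b) ≤ 1) ↔
      (∀ a b : Fin 2, Valued.v ((Y - ((((((localNonsplitEquiv (IsCMField.complexConj L) (Matrix.of fun i j : Fin 2 => if i.val + j.val + 1 = 2 then (1 : L) else 0) (IsCMField.complexConj_ne_one L) w hw) (γ₂) : ↥(unitaryGroupOfForm (galAdicCompletionMap (L := L) (IsCMField.complexConj L) hw) (placeForm (Matrix.of fun i j : Fin 2 => if i.val + j.val + 1 = 2 then (1 : L) else 0) w.1))) : GL (Fin 2) (w.1.adicCompletion L)) : Matrix (Fin 2) (Fin 2) (w.1.adicCompletion L))).trace / 2) • (1 : Matrix (Fin 2) (Fin 2) (w.1.adicCompletion L))) a b) ≤ Valued.v ((ϖ :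 (w.1.adicCompletion L)) ^ (2 * 0))) := by
    intro Y
    have hcab : ∀ a b : Fin 2, Valued.v (((((((localNonsplitEquiv (IsCMField.complexConj L) (Matrix.of fun i j : Fin 2 => if i.val + j.val + 1 = 2 then (1 : L) else 0) (IsCMField.complexConj_ne_one L) w hw) (γ₂) : ↥(unitaryGroupOfForm (galAdicCompletionMap (L := L) (IsCMField.complexConj L) hw) (placeForm (Matrix.of fun i j : Fin 2 => if i.val + j.val + 1 = 2 then (1 : L) else 0) w.1))) : GL (Fin 2) (w.1.adicCompletion L)) : Matrix (Fin 2) (Fin 2) (w.1.adicCompletion L))).trace / 2) * (1 : Matrix (Fin 2) (Fin 2) (w.1.adicCompletion L)) a b) ≤ 1 := by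
      intro a b; rw [map_mul]
      by_cases hab : a = b
      · rw [hab, Matrix.one_apply_eq, map_one, mul_one]; exact hc1
      · rw [Matrix.one_apply_ne hab, map_zero, mul_zero]; exact zero_le
    rw [mul_zero, pow_zero, map_one]
    constructor
    · intro h a b
      rw [Matrix.sub_apply, Matrix.smul_apply, smul_eq_mul]
      exact le_trans (Valuation.map_sub _ _ _) (max_le (h a b) (hcab a b))
    · intro h a b
      have e : Y a b = (Y - ((((((localNonsplitEquiv (IsCMField.complexConj L) (Matrix.of fun i j : Fin 2 => if i.val + j.val + 1 = 2 then (1 : L) else 0) (IsCMField.complexConj_ne_one L) w hw) (γ₂) : ↥(unitaryGroupOfForm (galAdicCompletionMap (L := L) (IsCMField.complexConj L) hw) (placeForm (Matrix.of fun i j : Fin 2 => if i.val + j.val + 1 = 2 then (1 : L) else 0) w.1))) : GL (Fin 2) (w.1.adicCompletion L)) : Matrix (Fin 2) (Fin 2) (w.1.adicCompletion L))).trace / 2) • (1 : Matrix (Fin 2) (Fin 2) (w.1.adicCompletion L))) a b + ((((((localNonsplitEquiv (IsCMField.complexConj L) (Matrix.of fun i j : Fin 2 => if i.val + j.val + 1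 = 2 then (1 : L) else 0) (IsCMField.complexConj_ne_one L) w hw) (γ₂) : ↥(unitaryGroupOfForm (galAdicCompletionMap (L := L) (IsCMField.complexConj L) hw) (placeForm (Matrix.of fun i j : Fin 2 => if i.val + j.val + 1 = 2 then (1 : L) else 0) w.1))) : GL (Fin 2) (w.1.adicCompletion L)) : Matrix (Fin 2) (Fin 2) (w.1.adicCompletion L))).trace / 2) * (1 : Matrix (Fin 2) (Fin 2) (w.1.adicCompletion L)) a b := by
        simp only [Matrix.sub_apply, Matrix.smul_apply, smul_eq_mul]; ring
      rw [e]; exact le_trans (Valuation.map_add _ _ _) (max_le (h a b) (hcab a b))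
  have hset : {B : Submodule (Valued.integer (w.1.adicCompletion L)) (Fin 2 → (w.1.adicCompletion L)) | UnitaryLatticeTree.IsSelfDualLattice (galAdicCompletionMap (L := L) (IsCMField.complexConj L) hw) (ϖ : (w.1.adicCompletion L)) (!![(0 : (w.1.adicCompletion L)), 1; 1, 0] : Matrix (Fin 2) (Fin 2) (w.1.adicCompletion L)) B ∧
        UnitaryLatticeTree.mapGL ((((localNonsplitEquiv (IsCMField.complexConj L) (Matrix.of fun i j : Fin 2 => if i.val + j.val + 1 = 2 then (1 : L) else 0) (IsCMField.complexConj_ne_one L) w hw) (γ₂) : ↥(unitaryGroupOfForm (galAdicCompletionMap (L := L) (IsCMField.complexConj L) hw) (placeForm (Matrix.of fun i j : Fin 2 => if i.val + j.val + 1 = 2 then (1 : L) else 0) w.1))) : GL (Fin 2) (w.1.adicCompletion L))) B = B} =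
      {B : Submodule (Valued.integer (w.1.adicCompletion L)) (Fin 2 → (w.1.adicCompletion L)) | UnitaryLatticeTree.IsSelfDualLattice (galAdicCompletionMap (L := L) (IsCMField.complexConj L) hw) (ϖ : (w.1.adicCompletion L)) (!![(0 : (w.1.adicCompletion L)), 1; 1, 0] : Matrix (Fin 2) (Fin 2) (w.1.adicCompletion L)) B ∧
        UnitaryLatticeTree.mapGL ((((localNonsplitEquiv (IsCMField.complexConj L) (Matrix.of fun i j : Fin 2 => if i.val + j.val + 1 = 2 then (1 : L) else 0) (IsCMField.complexConj_ne_one L) w hw) (γ₂) : ↥(unitaryGroupOfForm (galAdicCompletionMap (L := L) (IsCMField.complexConj L) hw) (placeForm (Matrix.of fun i j : Fin 2 => if i.val + j.val + 1 = 2 then (1 : L) else 0) w.1))) : GL (Fin 2) (w.1.adicCompletion L))) B = B ∧ True} := by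
    ext B; simp only [Set.mem_setOf_eq, and_true]
  rw [hset]
  symm
  refine natCard_cosets_eq_ncard_selfDual_fixed L v w hw he h2 hϖ1 γ₂
    (fun Y : Matrix (Fin 2) (Fin 2) (w.1.adicCompletion L) => ∀ a b : Fin 2, Valued.v ((Y - ((((((localNonsplitEquiv (IsCMField.complexConj L) (Matrix.of fun i j : Fin 2 => if i.val + j.val + 1 = 2 then (1 : L) else 0) (IsCMField.complexConj_ne_one L) w hw) (γ₂) : ↥(unitaryGroupOfForm (galAdicCompletionMap (L := L) (IsCMField.complexConj L) hw) (placeForm (Matrix.of fun i j : Fin 2 => if i.val + j.val + 1 = 2 then (1 : L) else 0) w.1))) : GL (Fin 2) (w.1.adicCompletion L)) : Matrix (Fin 2) (Fin 2) (w.1.adicCompletion L))).trace / 2) • (1 : Matrix (Fin 2) (Fin 2) (w.1.adicCompletion L))) a b) ≤ Valued.v ((ϖ : (w.1.adicCompletion L)) ^ (2 * 0)))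
    (fun Y hY => (hiff Y).2 hY) (fun k hk hkU Y hY => ?_) (fun B => True) (fun u hu hug => ?_)
  · rw [← hiff] at hY ⊢
    have hki := ((HermitianLatticeTree.mem_glInt_iff_forall_v_le_one_and_v_det_eq_one k).1 hk).1
    have hki' := ((HermitianLatticeTree.mem_glInt_iff_forall_v_le_one_and_v_det_eq_one k⁻¹).1 (inv_mem hk)).1
    exact forall_v_mul_mul_apply_le w.1 hki' hki hY
  · rw [← hiff]
    exact ⟨fun _ => trivial, fun _ => ((HermitianLatticeTree.mem_glInt_iff_forall_v_le_one_and_v_det_eq_one _).1 hug).1⟩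

include hw in
/-- **THE W-SIDE FIXED COUNT, EVEN DEPTH `2n`, `n ≥ 1`**: `#{B ∣ SD σ_w ϖ J B ∧ Γ·B = B} = (q+1)·Σ_(k<n) q^k` (★ II at `j = 0`; `C′ = K♯` discharged).
[cite: LabesseLanglands1979, §2 Lemma 2.1 p. 8] [cite: Rogawski1990, §4.9 p. 56] -/
theorem ncard_selfDual_fixed_of_even_depth_ramified (he : v.asIdeal.ramificationIdx' w.1.asIdeal ≠ 1) (h2 : IsUnit (2 : 𝒪[(w.1.adicCompletion L)]))
    (ϖ : (w.1.adicCompletion L)ˣ) (hϖ : Valued.v (ϖ : (w.1.adicCompletion L)) = WithZero.exp (-1 : ℤ))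
    (hσϖ : (galAdicCompletionMap (L := L) (IsCMField.complexConj L) hw) (ϖ : (w.1.adicCompletion L)) = -(ϖ : (w.1.adicCompletion L))) (γ₂ : ((cmDatum L 2 (Matrix.of fun i j : Fin 2 => if i.val + j.val + 1 = 2 then (1 : L) else 0)).Local v))
    (hirr : ¬ ∃ x : (w.1.adicCompletion L), ((((((localNonsplitEquiv (IsCMField.complexConj L) (Matrix.of fun i j : Fin 2 => if i.val + j.val + 1 = 2 then (1 : L) else 0) (IsCMField.complexConj_ne_one L) w hw) (γ₂) : ↥(unitaryGroupOfForm (galAdicCompletionMap (L := L) (IsCMField.complexConj L) hw) (placeForm (Matrix.of fun i j : Fin 2 => if i.val + j.val + 1 = 2 then (1 : L) else 0) w.1))) : GL (Fin 2) (w.1.adicCompletion L)) : Matrix (Fin 2) (Fin 2) (w.1.adicCompletion L))).charpoly).IsRoot x)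
    (h2deep : ∀ i j : Fin 2, Valued.v ((((((localNonsplitEquiv (IsCMField.complexConj L) (Matrix.of fun i j : Fin 2 => if i.val + j.val + 1 = 2 then (1 : L) else 0) (IsCMField.complexConj_ne_one L) w hw) (γ₂) : ↥(unitaryGroupOfForm (galAdicCompletionMap (L := L) (IsCMField.complexConj L) hw) (placeForm (Matrix.of fun i j : Fin 2 => if i.val + j.val + 1 = 2 then (1 : L) else 0) w.1))) : GL (Fin 2) (w.1.adicCompletion L)) : Matrix (Fin 2) (Fin 2) (w.1.adicCompletion L)) - 1) i j) ≤ Valued.v ((ϖ : (w.1.adicCompletion L)) ^ 2))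
    {n : ℕ} (hn1 : 1 ≤ n) (hN : Valued.v ((((((localNonsplitEquiv (IsCMField.complexConj L) (Matrix.of fun i j : Fin 2 => if i.val + j.val + 1 = 2 then (1 : L) else 0) (IsCMField.complexConj_ne_one L) w hw) (γ₂) : ↥(unitaryGroupOfForm (galAdicCompletionMap (L := L) (IsCMField.complexConj L) hw) (placeForm (Matrix.of fun i j : Fin 2 => if i.val + j.val + 1 = 2 then (1 : L) else 0) w.1))) : GL (Fin 2) (w.1.adicCompletion L)) : Matrix (Fin 2) (Fin 2) (w.1.adicCompletion L))).trace ^ 2 - 4 * (((((localNonsplitEquiv (IsCMField.complexConj L) (Matrix.of fun i j : Fin 2 => if i.val + j.val + 1 = 2 then (1 : L) else 0) (IsCMField.complexConj_ne_one L) w hw) (γ₂) : ↥(unitaryGroupOfForm (galAdicCompletionMap (L := L) (IsCMField.complexConj L) hw) (placeForm (Matrix.of fun i j : Fin 2 => if i.val + j.val + 1 = 2 then (1 : L) else 0) w.1))) : GL (Fin 2) (w.1.adicCompletion L)) : Matrix (Fin 2) (Fin 2) (w.1.adicCompletion L))).det) = WithZero.exp (-((2 * (2 * n) : ℕ) : ℤ)))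 :
    {B : Submodule (Valued.integer (w.1.adicCompletion L)) (Fin 2 → (w.1.adicCompletion L)) | UnitaryLatticeTree.IsSelfDualLattice (galAdicCompletionMap (L := L) (IsCMField.complexConj L) hw) (ϖ : (w.1.adicCompletion L)) (!![(0 : (w.1.adicCompletion L)), 1; 1, 0] : Matrix (Fin 2) (Fin 2) (w.1.adicCompletion L)) B ∧
        UnitaryLatticeTree.mapGL ((((localNonsplitEquiv (IsCMField.complexConj L) (Matrix.of fun i j : Fin 2 => if i.val + j.val + 1 = 2 then (1 : L) else 0) (IsCMField.complexConj_ne_one L) w hw) (γ₂) : ↥(unitaryGroupOfForm (galAdicCompletionMap (L := L) (IsCMField.complexConj L) hw) (placeForm (Matrix.of fun i j : Fin 2 => if i.val + j.val + 1 = 2 then (1 : L) else 0) w.1))) : GL (Fin 2) (w.1.adicCompletion L))) B = B}.ncard =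
      (Nat.card (𝓞 ↥(maximalRealSubfield L) ⧸ v.asIdeal) + 1) * ∑ k ∈ Finset.range n, Nat.card (𝓞 ↥(maximalRealSubfield L) ⧸ v.asIdeal) ^ k := by
  obtain ⟨C', hC's⟩ := exists_subgroup_forall_mem_iff_sharp L v w hw (ϖ : (w.1.adicCompletion L)) hϖ
  obtain ⟨hC'c, hC'o⟩ := isCompact_and_isOpen_of_forall_mem_iff_sharp L v w hw (ϖ : (w.1.adicCompletion L)) hϖ C' hC's
  have hC' : ∀ g : ((cmDatum L 2 (Matrix.of fun i j : Fin 2 => if i.val + j.val + 1 = 2 then (1 : L) else 0)).Local v), g ∈ C' ↔ (((localNonsplitEquiv (IsCMField.complexConj L) (Matrix.of fun i j : Fin 2 => if i.val + j.val + 1 = 2 then (1 : L) else 0) (IsCMField.complexConj_ne_one L) w hw) (g) : ↥(unitaryGroupOfForm (galAdicCompletionMap (L := L) (IsCMField.complexConj L) hw) (placeForm (Matrix.of fun i j : Fin 2 => if i.val + j.val + 1 = 2 then (1 : L) else 0) w.1))) : GL (Fin 2) (w.1.adicCompletion L)) ∈ (glInt 2 (w.1.adicCompletion L)).map (MulAut.conj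 (glDiagonal 2 (w.1.adicCompletion L) ![1, ϖ])).toMonoidHom :=
    fun g => (hC's g).trans (forall_v_sharp_iff_coe_mem_map_conj L w hw ϖ ((localNonsplitEquiv (IsCMField.complexConj L) (Matrix.of fun i j : Fin 2 => if i.val + j.val + 1 = 2 then (1 : L) else 0) (IsCMField.complexConj_ne_one L) w hw) g))
  rw [ncard_selfDual_fixed_eq_natCard_depthZero L v w hw he h2 ϖ hϖ γ₂ h2deep]
  have h := (natCard_depthFixed_selfDual_and_modular_of_even_depth_ramified L v w hw he h2 ϖ hϖ hσϖ C' hC' hC'o hC'c γ₂ hirr hN (j := 0) (by omega)).1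
  rwa [Nat.sub_zero] at h

include hw in
/-- **THE W-SIDE FIXED COUNT, ODD DEPTH `2n+1`**: `#{B ∣ SD σ_w ϖ J B ∧ Γ·B = B} + 1 = 2·Σ_(k<n+1) q^k` (★ III at `j = 0`; `C′ = K♯` discharged).
[cite: LabesseLanglands1979, §2 Lemma 2.1 p. 8] [cite: Rogawski1990, §4.9 p. 56] -/
theorem ncard_selfDual_fixed_of_odd_depth_ramified (he : v.asIdeal.ramificationIdx' w.1.asIdeal ≠ 1) (h2 : IsUnit (2 : 𝒪[(w.1.adicCompletion L)]))
    (ϖ : (w.1.adicCompletion L)ˣ) (hϖ : Valued.v (ϖ : (w.1.adicCompletion L)) = WithZero.exp (-1 : ℤ))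
    (hσϖ : (galAdicCompletionMap (L := L) (IsCMField.complexConj L) hw) (ϖ : (w.1.adicCompletion L)) = -(ϖ : (w.1.adicCompletion L))) (γ₂ : ((cmDatum L 2 (Matrix.of fun i j : Fin 2 => if i.val + j.val + 1 = 2 then (1 : L) else 0)).Local v))
    (hirr : ¬ ∃ x : (w.1.adicCompletion L), ((((((localNonsplitEquiv (IsCMField.complexConj L) (Matrix.of fun i j : Fin 2 => if i.val + j.val + 1 = 2 then (1 : L) else 0) (IsCMField.complexConj_ne_one L) w hw) (γ₂) : ↥(unitaryGroupOfForm (galAdicCompletionMap (L := L) (IsCMField.complexConj L) hw) (placeForm (Matrix.of fun i j : Fin 2 => if i.val + j.val + 1 = 2 then (1 : L) else 0) w.1))) : GL (Fin 2) (w.1.adicCompletion L)) : Matrix (Fin 2) (Fin 2) (w.1.adicCompletion L))).charpoly).IsRoot x)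
    (h2deep : ∀ i j : Fin 2, Valued.v ((((((localNonsplitEquiv (IsCMField.complexConj L) (Matrix.of fun i j : Fin 2 => if i.val + j.val + 1 = 2 then (1 : L) else 0) (IsCMField.complexConj_ne_one L) w hw) (γ₂) : ↥(unitaryGroupOfForm (galAdicCompletionMap (L := L) (IsCMField.complexConj L) hw) (placeForm (Matrix.of fun i j : Fin 2 => if i.val + j.val + 1 = 2 then (1 : L) else 0) w.1))) : GL (Fin 2) (w.1.adicCompletion L)) : Matrix (Fin 2) (Fin 2) (w.1.adicCompletion L)) - 1) i j) ≤ Valued.v ((ϖ : (w.1.adicCompletion L)) ^ 2))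
    {n : ℕ} (hN : Valued.v ((((((localNonsplitEquiv (IsCMField.complexConj L) (Matrix.of fun i j : Fin 2 => if i.val + j.val + 1 = 2 then (1 : L) else 0) (IsCMField.complexConj_ne_one L) w hw) (γ₂) : ↥(unitaryGroupOfForm (galAdicCompletionMap (L := L) (IsCMField.complexConj L) hw) (placeForm (Matrix.of fun i j : Fin 2 => if i.val + j.val + 1 = 2 then (1 : L) else 0) w.1))) : GL (Fin 2) (w.1.adicCompletion L)) : Matrix (Fin 2) (Fin 2) (w.1.adicCompletion L))).trace ^ 2 - 4 * (((((localNonsplitEquiv (IsCMField.complexConj L) (Matrix.of fun i j : Fin 2 => if i.val + j.val + 1 = 2 then (1 : L) else 0) (IsCMField.complexConj_ne_one L) w hw) (γ₂) : ↥(unitaryGroupOfForm (galAdicCompletionMap (L := L) (IsCMField.complexConj L) hw) (placeForm (Matrix.of fun i j : Fin 2 => if i.val + j.val + 1 = 2 then (1 : L) else 0) w.1))) : GL (Fin 2) (w.1.adicCompletion L)) : Matrix (Fin 2) (Fin 2) (w.1.adicCompletion L))).det) = WithZero.exp (-((2 * (2 * n + 1) : ℕ) : ℤ))) :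
    {B : Submodule (Valued.integer (w.1.adicCompletion L)) (Fin 2 → (w.1.adicCompletion L)) | UnitaryLatticeTree.IsSelfDualLattice (galAdicCompletionMap (L := L) (IsCMField.complexConj L) hw) (ϖ : (w.1.adicCompletion L)) (!![(0 : (w.1.adicCompletion L)), 1; 1, 0] : Matrix (Fin 2) (Fin 2) (w.1.adicCompletion L)) B ∧
        UnitaryLatticeTree.mapGL ((((localNonsplitEquiv (IsCMField.complexConj L) (Matrix.of fun i j : Fin 2 => if i.val + j.val + 1 = 2 then (1 : L) else 0) (IsCMField.complexConj_ne_one L) w hw) (γ₂) : ↥(unitaryGroupOfForm (galAdicCompletionMap (L := L) (IsCMField.complexConj L) hw) (placeForm (Matrix.of fun i j : Fin 2 => if i.val + j.val + 1 = 2 then (1 : L) else 0) w.1))) : GL (Fin 2) (w.1.adicCompletion L))) B = B}.ncard + 1 =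
      2 * ∑ k ∈ Finset.range (n + 1), Nat.card (𝓞 ↥(maximalRealSubfield L) ⧸ v.asIdeal) ^ k := by
  obtain ⟨C', hC's⟩ := exists_subgroup_forall_mem_iff_sharp L v w hw (ϖ : (w.1.adicCompletion L)) hϖ
  obtain ⟨hC'c, hC'o⟩ := isCompact_and_isOpen_of_forall_mem_iff_sharp L v w hw (ϖ : (w.1.adicCompletion L)) hϖ C' hC's
  have hC' : ∀ g : ((cmDatum L 2 (Matrix.of fun i j : Fin 2 => if i.val + j.val + 1 = 2 then (1 : L) else 0)).Local v), g ∈ C' ↔ (((localNonsplitEquiv (IsCMField.complexConj L) (Matrix.of fun i j : Fin 2 => if i.val + j.val + 1 = 2 then (1 : L) else 0) (IsCMField.complexConj_ne_one L) w hw) (g) : ↥(unitaryGroupOfForm (galAdicCompletionMap (L := L) (IsCMField.complexConj L) hw) (placeForm (Matrix.of fun i j : Fin 2 => if i.val + j.val + 1 = 2 then (1 : L) else 0) w.1))) : GL (Fin 2) (w.1.adicCompletion L)) ∈ (glInt 2 (w.1.adicCompletion L)).map (MulAut.conj (glDiagonal 2 (w.1.adicCompletion L) ![1, ϖ])).toMonoidHom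 :=
    fun g => (hC's g).trans (forall_v_sharp_iff_coe_mem_map_conj L w hw ϖ ((localNonsplitEquiv (IsCMField.complexConj L) (Matrix.of fun i j : Fin 2 => if i.val + j.val + 1 = 2 then (1 : L) else 0) (IsCMField.complexConj_ne_one L) w hw) g))
  rw [ncard_selfDual_fixed_eq_natCard_depthZero L v w hw he h2 ϖ hϖ γ₂ h2deep]
  have h := (natCard_depthFixed_selfDual_and_modular_of_odd_depth_ramified L v w hw he h2 ϖ hϖ hσϖ C' hC' hC'o hC'c γ₂ hirr hN (j := 0) (Nat.zero_le n)).1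
  rwa [Nat.sub_zero] at h

end Census

end Literature.NumberTheory.Automorphic.UnitaryGroup

end
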